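import Summits.MatrixMultiplication.MatrixMultiplication.Theorems.ObstructionDescentSlotCharacterGroup

set_option linter.dupNamespace false

/-!
# Obstruction descent, part AC — THE RANK-RESTRICTED WINDOW LAW and the LOW-RANK TRANSFER STEP

`route-MatrixMultiplication-ObstructionDescent`, aside `InvariantSaturation` (stmt 32282); decomp-mm lens-3, NODE-g16.

Parts H/I prove the CUBE LAW: a full-format level-`k` vector whose unit window `y ↦ f(y⁰ + e_{abc})` is dead at EVERY point
vanishes on `σ_r`, `(k−1)r < km`.  Reading the proof chain point by point shows the dead window is only ever used at points of
rank `≤ r − 1`: the secant argument evaluates line degrees at partial sums of `r − 1` weighted triads (§2), covariance moves such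
a point by `GL_m³` (rank preserved, §3), and the top coefficient of `u ↦ f(y + u·e_{abc})` is the window value at the SAME
point `y` (§1, the pointwise form of part I).  Hence:

* §4 **`evalT_eq_zero_of_unitWindow_rank`** — RANK-RESTRICTED CUBE LAW: `f ∈ R_k(m)`, window dead at every `y` of rank
  `≤ r − 1`, `(k−1)r < km`, `R(t) ≤ r` ⇒ `f(t) = 0`.
* §5 **`evalT_permT_eq_mul_of_lowRank`** — LOW-RANK TRANSFER STEP: if `σ` acts by the scalar `χ` on the corner space
  `R_k(m')` ON TENSORS OF RANK `≤ ρ` only (values, not a polynomial identity), then every `f ∈ R_k(m'+1)` satisfies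
  `f(σ·t) = χ·f(t)` for `R(t) ≤ r` whenever `(k−1)r < k(m'+1)` and `r ≤ ρ + 1`.  Unlike part AA's transfer law (which needs
  the polynomial identity `G^σ = χG` on `R_k(m')`) this step ITERATES along the format tower — part AD.

[cite: BurgisserIkenmeyer2011, §3.1–3.2, §6.2], [cite: BurgisserIkenmeyer2017, §5], [cite: LandsbergGCT2017, §2.1, §8.3].
-/

noncomputable section

open scoped BigOperators
open Finset

namespace Summit.MatrixMultiplication.MatrixMultiplication.Theorems.ObstructionCalculus

open Literature.Computability.AlgebraicComplexity (actTensor actTensor_apply actTensor_actTensor actTensor_one actTensor_triad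
  triad triad_apply tensorRank exists_eq_sum_triad_of_tensorRank_le tensorRank_le_of_eq_sum tensorRank_sum_le
  tensorRestrictsTo_actTensor TensorRestrictsTo)

variable {m : ℕ}

/-! ### §1 Pointwise coordinate degree from a dead window value (part I, point by point) -/

section Pointwise

/-- **Pointwise coordinate degree.**  For a weight vector `f` of type `Λ` with weight `k` at the cell `e = (a,b,c)` in each
slot and ONE point `y`: if the window value `f(y⁰ + e_{abc})` vanishes (`y⁰` = `y` with the three slices through `e` put
to zero), then `u ↦ f(y + u·e_{abc})` has degree `≤ k − 1`.  (Part I's `coordDegree_of_unitWindow`, whose proof uses the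
dead window only at the point itself.) [this node] -/
theorem coordDegree_of_unitWindow_at {Λ : Fin 3 → Fin m → ℕ} {d k : ℕ} {f : MvPolynomial (Idx m) ℂ}
    (hf : f ∈ hwvSpace Λ d) {a b c : Fin m} (ha : Λ 0 a = k) (hb : Λ 1 b = k) (hc : Λ 2 c = k)
    (y : Tensor ℂ m)
    (hdead : evalT ((fun x y' z => if x = a ∨ y' = b ∨ z = c then 0 else y x y' z) +
        triad (Pi.single a 1) (Pi.single b 1) (Pi.single c 1)) f = 0) :
    ∃ Q : Polynomial ℂ, Q.natDegree ≤ k - 1 ∧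
      ∀ u : ℂ, evalT (y + u • triad (Pi.single a 1) (Pi.single b 1) (Pi.single c 1)) f = Q.eval u := by
  classical
  set e : Idx m := (a, b, c) with he
  set yv : Idx m → ℂ := fun p => y p.1 p.2.1 p.2.2 with hyv
  set g : Idx m → Polynomial ℂ := fun p => Polynomial.C (yv p) + if p = e then Polynomial.X else 0 with hg
  have hge : ∀ p, p ≠ e → g p = Polynomial.C (yv p) := fun p hp => by rw [hg]; simp [hp]
  have hgee : g e = Polynomial.C (yv e) + Polynomial.X := by rw [hg]; simp
  have hEC := fun {μ : Idx m →₀ ℕ} (hμ : μ ∈ f.support) => exponent_at_cell hf ha hb hc hμ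
  refine ⟨MvPolynomial.aeval g f, ?_, fun u => ?_⟩
  · -- (1) the expansion of `f(y + u e)` as a sum over the monomials of `f`
    have hexp : MvPolynomial.aeval g f =
        ∑ μ ∈ f.support, Polynomial.C (f.coeff μ) * ∏ p ∈ μ.support, g p ^ μ p := by
      conv_lhs => rw [f.as_sum]
      rw [map_sum]
      refine Finset.sum_congr rfl fun μ _ => ?_
      rw [MvPolynomial.aeval_monomial, Polynomial.algebraMap_eq, Finsupp.prod]
    -- (2) terms with `μ_e ≠ k` have degree `≤ k - 1`
    have hlow : ∀ μ ∈ f.support.filter (fun μ => μ e ≠ k),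
        (Polynomial.C (f.coeff μ) * ∏ p ∈ μ.support, g p ^ μ p).natDegree ≤ k - 1 := by
      intro μ hμ
      rw [Finset.mem_filter] at hμ
      have hle : μ e ≤ k := (hEC hμ.1).1
      refine (Polynomial.natDegree_C_mul_le _ _).trans ((Polynomial.natDegree_prod_le _ _).trans ?_)
      have hdeg : ∀ p ∈ μ.support, (g p ^ μ p).natDegree ≤ if p = e then μ e else 0 := by
        intro p _
        by_cases hp : p = e
        · rw [if_pos hp, hp, hgee]
          refine Polynomial.natDegree_pow_le.trans ?_
          have h1 : (Polynomial.C (yv e) + Polynomial.X).natDegree ≤ 1 :=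
            (Polynomial.natDegree_add_le _ _).trans
              (max_le ((Polynomial.natDegree_C _).le.trans zero_le_one) Polynomial.natDegree_X_le)
          calc μ e * (Polynomial.C (yv e) + Polynomial.X).natDegree ≤ μ e * 1 := Nat.mul_le_mul_left _ h1
            _ = μ e := mul_one _
        · rw [if_neg hp, hge p hp, ← map_pow, Polynomial.natDegree_C]
      refine (Finset.sum_le_sum hdeg).trans ?_
      rw [Finset.sum_ite_eq' μ.support e]
      split_ifs
      · omega
      · exact Nat.zero_le _
    -- (3) the top terms, `μ_e = k`, sum to `(y_e + X)^k · H` with `H = f(y⁰ + e_{abc}) = 0`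
    have htopterm : ∀ μ ∈ f.support.filter (fun μ => μ e = k),
        Polynomial.C (f.coeff μ) * ∏ p ∈ μ.support, g p ^ μ p =
          (Polynomial.C (yv e) + Polynomial.X) ^ k *
            Polynomial.C (f.coeff μ * ∏ p ∈ μ.support.filter (fun p => p ≠ e), yv p ^ μ p) := by
      intro μ hμ
      rw [Finset.mem_filter] at hμ
      have hprod : ∏ p ∈ μ.support, g p ^ μ p =
          ∏ p ∈ μ.support, (if p = e then (Polynomial.C (yv e) + Polynomial.X) ^ k
            else Polynomial.C (yv p ^ μ p)) := by
        refine Finset.prod_congr rfl fun p _ => ?_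
        by_cases hp : p = e
        · rw [if_pos hp, hp, hgee, hμ.2]
        · rw [if_neg hp, hge p hp, map_pow]
      rw [hprod, Finset.prod_ite, Finset.prod_const, Finset.filter_eq' μ.support e, map_mul, map_prod]
      by_cases hmem : e ∈ μ.support
      · rw [if_pos hmem, Finset.card_singleton, pow_one]
        ring
      · rw [if_neg hmem, Finset.card_empty, pow_zero, one_mul]
        have hk0 : k = 0 := by rw [← hμ.2]; exact Finsupp.notMem_support_iff.mp hmem
        rw [hk0, pow_zero, one_mul]
    have hH : ∑ μ ∈ f.support.filter (fun μ => μ e = k),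
        f.coeff μ * ∏ p ∈ μ.support.filter (fun p => p ≠ e), yv p ^ μ p = 0 := by
      have h0 := hdead
      rw [evalT, MvPolynomial.aeval_eq_eval, MvPolynomial.eval_eq,
        ← Finset.sum_filter_add_sum_filter_not f.support (fun μ => μ e = k)] at h0
      set z : Idx m → ℂ := fun p => ((fun x y' z => if x = a ∨ y' = b ∨ z = c then (0 : ℂ) else y x y' z) +
        triad (Pi.single a (1 : ℂ)) (Pi.single b 1) (Pi.single c 1)) p.1 p.2.1 p.2.2 with hz
      have hzp : ∀ p : Idx m, z p = (if p.1 = a ∨ p.2.1 = b ∨ p.2.2 = c then (0 : ℂ) else yv p) +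
          if p = e then 1 else 0 := by
        intro p
        rw [hz, he]
        simp only [Pi.add_apply, triad_single_apply, Prod.mk.eta, hyv]
      have hnot : ∑ μ ∈ f.support.filter (fun μ => ¬μ e = k), f.coeff μ * ∏ p ∈ μ.support, z p ^ μ p = 0 := by
        refine Finset.sum_eq_zero fun μ hμ => ?_
        rw [Finset.mem_filter] at hμ
        obtain ⟨p, hp, hpe, hpa⟩ := (hEC hμ.1).2.2 hμ.2
        have hz0 : z p = 0 := by rw [hzp p, if_pos (Or.inl hpa), if_neg hpe, add_zero]
        rw [Finset.prod_eq_zero hp (by rw [hz0, zero_pow (Finsupp.mem_support_iff.mp hp)]), mul_zero]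
      have hyes : ∀ μ ∈ f.support.filter (fun μ => μ e = k), f.coeff μ * ∏ p ∈ μ.support, z p ^ μ p =
          f.coeff μ * ∏ p ∈ μ.support.filter (fun p => p ≠ e), yv p ^ μ p := by
        intro μ hμ
        rw [Finset.mem_filter] at hμ
        have hzz : ∀ p ∈ μ.support, z p ^ μ p = if p ≠ e then yv p ^ μ p else 1 := by
          intro p hp
          by_cases hpe : p = e
          · rw [if_neg (not_not.mpr hpe), hzp p, if_pos hpe, hpe, he]
            simp
          · obtain ⟨h1, h2, h3⟩ := (hEC hμ.1).2.1 hμ.2 p hp hpe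
            rw [if_pos hpe, hzp p, if_neg hpe, if_neg (not_or.mpr ⟨h1, not_or.mpr ⟨h2, h3⟩⟩), add_zero]
        rw [Finset.prod_congr rfl hzz, Finset.prod_ite, Finset.prod_const_one, mul_one]
      rw [hnot, add_zero, Finset.sum_congr rfl hyes] at h0
      exact h0
    have htop : ∑ μ ∈ f.support.filter (fun μ => μ e = k),
        Polynomial.C (f.coeff μ) * ∏ p ∈ μ.support, g p ^ μ p = 0 := by
      rw [Finset.sum_congr rfl htopterm, ← Finset.mul_sum, ← map_sum, hH, map_zero, mul_zero]
    rw [hexp, ← Finset.sum_filter_add_sum_filter_not f.support (fun μ => μ e = k), htop, zero_add]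
    exact Polynomial.natDegree_sum_le_of_forall_le _ _ hlow
  · -- evaluation at `u`
    rw [← Polynomial.coe_aeval_eq_eval, MvPolynomial.comp_aeval_apply, evalT]
    have hfun : (fun p : Idx m => (Polynomial.aeval u) (g p)) =
        fun p : Idx m => (y + u • triad (Pi.single a (1 : ℂ)) (Pi.single b 1) (Pi.single c 1)) p.1 p.2.1 p.2.2 := by
      funext p
      rw [hg, he]
      simp only [map_add, Polynomial.aeval_C, Algebra.algebraMap_self_apply, apply_ite (Polynomial.aeval u),
        Polynomial.aeval_X, map_zero, Pi.add_apply, Pi.smul_apply, smul_eq_mul, triad_single_apply, Prod.mk.eta, hyv]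
      split_ifs <;> ring
    rw [hfun]


end Pointwise

/-! ### §2 Secant vanishing from line degrees AT THE SECANT POINTS -/

section Secant

/-- **Secant vanishing, pointwise hypotheses.**  If `f` is homogeneous of degree `D` and, for every weight vector `c` and
every `i`, `u ↦ f(Σ_{j ≠ i} c_j t_j + u·t_i)` has degree `≤ δ`, then `f(t₁ + ⋯ + t_r) = 0` as soon as `δ·r < D`.
(Part H's `evalT_sum_eq_zero_of_lineDegree` asks this at every base point; its proof uses exactly these.) [this node] -/
theorem evalT_sum_eq_zero_of_lineDegree_at {r D δ : ℕ} {f : MvPolynomial (Idx m) ℂ} (hf : f.IsHomogeneous D)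
    (t : Fin r → Tensor ℂ m)
    (hline : ∀ (c : Fin r → ℂ) (i : Fin r), ∃ Q : Polynomial ℂ, Q.natDegree ≤ δ ∧
      ∀ u : ℂ, evalT ((∑ j ∈ Finset.univ \ {i}, c j • t j) + u • t i) f = Q.eval u)
    (hD : δ * r < D) : evalT (∑ i, t i) f = 0 := by
  have hΦ : MvPolynomial.aeval
      (fun p : Idx m => ∑ i : Fin r, MvPolynomial.C (t i p.1 p.2.1 p.2.2) * MvPolynomial.X i) f = 0 := by
    refine eq_zero_of_isHomogeneous_of_lineDegree (secant_isHomogeneous t hf) (fun i c => ?_)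
      (by simpa only [Fintype.card_fin] using hD)
    obtain ⟨Q, hQδ, hQ⟩ := hline c i
    refine ⟨Q, hQδ, fun u => ?_⟩
    rw [eval_secant, ← hQ u]
    have hfun : (fun j => Function.update c i u j • t j) = Function.update (fun j => c j • t j) i (u • t i) := by
      funext j
      by_cases hj : j = i
      · subst hj
        simp
      · simp [Function.update_of_ne hj]
    rw [hfun, Finset.sum_update_of_mem (Finset.mem_univ i), add_comm]
  have h := eval_secant t f fun _ => 1
  rw [hΦ, map_zero] at h
  simpa only [one_smul] using h.symm

/-- A weighted sum of triads over `univ ∖ {i}` has rank `≤ r − 1`. [bookkeeping] -/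
theorem tensorRank_sum_erase_smul_triad_le {r : ℕ} (i : Fin r) (c : Fin r → ℂ) (w u v : Fin r → Fin m → ℂ) :
    tensorRank (∑ j ∈ Finset.univ \ {i}, c j • (triad (w j) (u j) (v j) : Tensor ℂ m)) ≤ r - 1 := by
  refine (tensorRank_sum_le _ _).trans ?_
  have hcard : (Finset.univ \ {i} : Finset (Fin r)).card = r - 1 := by
    rw [Finset.card_univ_sdiff, Fintype.card_fin, Finset.card_singleton]
  calc ∑ j ∈ Finset.univ \ {i}, tensorRank (c j • (triad (w j) (u j) (v j) : Tensor ℂ m))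
      ≤ ∑ j ∈ Finset.univ \ {i}, 1 := Finset.sum_le_sum fun j _ => ?_
    _ = r - 1 := by rw [Finset.sum_const, smul_eq_mul, mul_one, hcard]
  rw [smul_triad]
  exact tensorRank_le_of_eq_sum (r := 1) (fun _ => c j • w j) (fun _ => u j) (fun _ => v j) (by rw [Fin.sum_univ_one])

end Secant

/-! ### §3 Covariance, pointwise -/

section Covariance

/-- Pointwise transport of a line-degree bound along the group: if `f((A,B,C)·t) = χ f(t)` and `u ↦ f(y' + u·v)` has degree
`≤ δ` at the ONE point `y' = (A,B,C)⁻¹·y`, then `u ↦ f(y + u·(A,B,C)·v)` has degree `≤ δ`. [this node] -/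
theorem lineDegree_actTensor_at {f : MvPolynomial (Idx m) ℂ} {δ : ℕ} {A B C : Matrix (Fin m) (Fin m) ℂ}
    (hA : A.det ≠ 0) (hB : B.det ≠ 0) (hC : C.det ≠ 0) {χ : ℂ}
    (hχ : ∀ t : Tensor ℂ m, evalT (actTensor A B C t) f = χ * evalT t f) {v : Tensor ℂ m} (y : Tensor ℂ m)
    (hdeg : ∃ Q : Polynomial ℂ, Q.natDegree ≤ δ ∧
      ∀ u : ℂ, evalT (actTensor A⁻¹ B⁻¹ C⁻¹ y + u • v) f = Q.eval u) :
    ∃ Q : Polynomial ℂ, Q.natDegree ≤ δ ∧ ∀ u : ℂ, evalT (y + u • actTensor A B C v) f = Q.eval u := by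
  obtain ⟨Q, hQδ, hQ⟩ := hdeg
  refine ⟨Polynomial.C χ * Q, (Polynomial.natDegree_C_mul_le χ Q).trans hQδ, fun u => ?_⟩
  have hy : y = actTensor A B C (actTensor A⁻¹ B⁻¹ C⁻¹ y) := by
    rw [actTensor_actTensor, Matrix.mul_nonsing_inv A (isUnit_iff_ne_zero.mpr hA),
      Matrix.mul_nonsing_inv B (isUnit_iff_ne_zero.mpr hB), Matrix.mul_nonsing_inv C (isUnit_iff_ne_zero.mpr hC),
      actTensor_one]
  rw [Polynomial.eval_mul, Polynomial.eval_C, ← hQ u, ← hχ, actTensor_add', actTensor_smul', ← hy]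

/-- **Secant vanishing from a coordinate degree bound ON LOW RANK.**  Let `f` be a weight vector of a slotwise-constant type
`Λ` in degree `D` such that along the coordinate direction `e_{abc}` and through every point `y` OF RANK `≤ r − 1` the
polynomial `u ↦ f(y + u·e_{abc})` has degree `≤ δ`.  Then `f` vanishes at every tensor of rank `≤ r` if `δ·r < D`.
[this node] -/
theorem evalT_eq_zero_of_coordDegree_rank {Λ : Fin 3 → Fin m → ℕ} {D δ : ℕ} {f : MvPolynomial (Idx m) ℂ}
    (hf : f ∈ hwvSpace Λ D) (hΛ : ∀ (s : Fin 3) (i j : Fin m), Λ s i = Λ s j) {a b c : Fin m} {r : ℕ}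
    (hdeg : ∀ y : Tensor ℂ m, tensorRank y ≤ r - 1 → ∃ Q : Polynomial ℂ, Q.natDegree ≤ δ ∧
      ∀ u : ℂ, evalT (y + u • triad (Pi.single a 1) (Pi.single b 1) (Pi.single c 1)) f = Q.eval u)
    (hr : δ * r < D) {t : Tensor ℂ m} (ht : tensorRank t ≤ r) : evalT t f = 0 := by
  obtain ⟨w, u, v, rfl⟩ := exists_eq_sum_triad_of_tensorRank_le ht
  refine evalT_sum_eq_zero_of_lineDegree_at hf.1 (fun i => triad (w i) (u i) (v i)) (fun cw i => ?_) hr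
  have hy := tensorRank_sum_erase_smul_triad_le (m := m) i cw w u v
  by_cases h0 : w i = 0 ∨ u i = 0 ∨ v i = 0
  · refine ⟨Polynomial.C (evalT (∑ j ∈ Finset.univ \ {i}, cw j • (triad (w j) (u j) (v j) : Tensor ℂ m)) f),
      (Polynomial.natDegree_C _).le.trans (Nat.zero_le _), fun s => ?_⟩
    rw [triad_eq_zero_of_factor h0, smul_zero, add_zero, Polynomial.eval_C]
  · have h0' : w i ≠ 0 ∧ u i ≠ 0 ∧ v i ≠ 0 :=
      ⟨fun h => h0 (Or.inl h), fun h => h0 (Or.inr (Or.inl h)), fun h => h0 (Or.inr (Or.inr h))⟩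
    obtain ⟨A, B, C, hA, hB, hC, hABC⟩ := exists_actTensor_coord_eq_triad h0'.1 h0'.2.1 h0'.2.2 a b c
    obtain ⟨χ, -, hχ⟩ := exists_evalT_actTensor_eq_mul hf hΛ hA hB hC
    rw [← hABC]
    exact lineDegree_actTensor_at hA hB hC hχ _
      (hdeg _ (((tensorRestrictsTo_actTensor A⁻¹ B⁻¹ C⁻¹ _).tensorRank_le).trans hy))

end Covariance

/-! ### §4 The rank-restricted cube law -/

section CubeLaw

/-- **RANK-RESTRICTED CUBE LAW.**  A level-`k` vector `f` of the full format `m` whose unit window at a cell `(a,b,c)` is dead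
AT EVERY POINT OF RANK `≤ r − 1` — `f(y⁰ + e_{abc}) = 0` whenever `R(y) ≤ r − 1` — vanishes at every tensor of rank `≤ r`
as soon as `(k−1)·r < k·m`.  (Part I's cube law asks the window dead everywhere.) [this node] -/
theorem evalT_eq_zero_of_unitWindow_rank {k : ℕ} {f : MvPolynomial (Idx m) ℂ}
    (hf : f ∈ hwvSpace (rectType m m k) (k * m)) {a b c : Fin m} {r : ℕ}
    (hdead : ∀ y : Tensor ℂ m, tensorRank y ≤ r - 1 →
      evalT ((fun x y' z => if x = a ∨ y' = b ∨ z = c then 0 else y x y' z) +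
        triad (Pi.single a 1) (Pi.single b 1) (Pi.single c 1)) f = 0)
    (hr : (k - 1) * r < k * m) {t : Tensor ℂ m} (ht : tensorRank t ≤ r) : evalT t f = 0 :=
  evalT_eq_zero_of_coordDegree_rank hf (fun s i j => rectType_self_const k s i j)
    (fun y hy => coordDegree_of_unitWindow_at hf (rectType_self_apply k 0 a) (rectType_self_apply k 1 b)
      (rectType_self_apply k 2 c) y (hdead y hy)) hr ht

/-- Point/pass-level language: under a rank-restricted dead window, `f` lies in the ideal of the orbit of every `u` of rank
`≤ r`. [this node] -/
theorem mem_orbitVanishing_of_unitWindow_rank {k : ℕ} {f : MvPolynomial (Idx m) ℂ}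
    (hf : f ∈ hwvSpace (rectType m m k) (k * m)) {a b c : Fin m} {r : ℕ}
    (hdead : ∀ y : Tensor ℂ m, tensorRank y ≤ r - 1 →
      evalT ((fun x y' z => if x = a ∨ y' = b ∨ z = c then 0 else y x y' z) +
        triad (Pi.single a 1) (Pi.single b 1) (Pi.single c 1)) f = 0)
    (hr : (k - 1) * r < k * m) {u : Tensor ℂ m} (hu : tensorRank u ≤ r) : f ∈ orbitVanishing u := by
  intro A B C _ _ _
  exact evalT_eq_zero_of_unitWindow_rank hf hdead hr (((tensorRestrictsTo_actTensor A B C u).tensorRank_le).trans hu)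

end CubeLaw

/-! ### §5 The low-rank transfer step -/

section TransferStep

variable {m' : ℕ}

/-- **LOW-RANK TRANSFER STEP.**  Suppose the slot permutation `σ` acts by the scalar `χ` on the corner level space
`R_k(m') ⊂ ℂ[ℂ^{m'+1} ⊗ ℂ^{m'+1} ⊗ ℂ^{m'+1}]` (type `((k^{m'}))³` in format `m' + 1`) ON TENSORS OF RANK `≤ ρ`:
`W(σ·s) = χ·W(s)` for `W ∈ R_k(m')`, `R(s) ≤ ρ`.  Then every `f ∈ R_k(m'+1)` satisfies `f(σ·t) = χ·f(t)` for `R(t) ≤ r`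
whenever `(k−1)·r < k·(m'+1)` and `r ≤ ρ + 1`: the unit window of `f^σ − χ·f` at the cell `(0,0,0)` is the difference
`W(σ·y) − χ·W(y)` for the window function `W` of `f`, dead on rank `≤ ρ`, and the rank-restricted cube law fires. [this node] -/
theorem evalT_permT_eq_mul_of_lowRank {k ρ : ℕ} (σ : Equiv.Perm (Fin 3)) {χ : ℂ}
    (hV : ∀ W ∈ hwvSpace (rectType (m' + 1) m' k) (k * m'), ∀ s : Tensor ℂ (m' + 1), tensorRank s ≤ ρ →
      evalT (permT σ s) W = χ * evalT s W)
    {f : MvPolynomial (Idx (m' + 1)) ℂ} (hf : f ∈ hwvSpace (rectType (m' + 1) (m' + 1) k) (k * (m' + 1)))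
    {r : ℕ} (hr : (k - 1) * r < k * (m' + 1)) (hρ : r ≤ ρ + 1) {t : Tensor ℂ (m' + 1)} (ht : tensorRank t ≤ r) :
    evalT (permT σ t) f = χ * evalT t f := by
  have hD := rename_sub_smul_mem_level σ χ hf
  have hW : restrictB m' (triad (Pi.single (0 : Fin (m' + 1)) (1 : ℂ)) (Pi.single 0 1) (Pi.single 0 1)) f ∈
      hwvSpace (rectType (m' + 1) m' k) (k * m') :=
    restrictB_mem_hwvSpace (Nat.le_succ m') (Nat.le_succ m') (triad_single_zero_mem_blockDiag m') hf
  have he : permT σ (triad (Pi.single (0 : Fin (m' + 1)) (1 : ℂ)) (Pi.single 0 1) (Pi.single 0 1)) =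
      triad (Pi.single (0 : Fin (m' + 1)) (1 : ℂ)) (Pi.single 0 1) (Pi.single 0 1) := permT_triad_diag σ _
  have hDt : evalT t (MvPolynomial.rename (slotPerm σ) f - χ • f) = 0 := by
    refine evalT_eq_zero_of_unitWindow_rank hD (a := 0) (b := 0) (c := 0) (fun y hy => ?_) hr ht
    rw [← mixT_triad_single_zero, map_sub, map_smul, evalT_rename_slotPerm, permT_mixT, he, ← evalT_restrictB,
      ← evalT_restrictB, hV _ hW y (hy.trans (by omega)), smul_eq_mul, sub_self]
  rwa [map_sub, map_smul, evalT_rename_slotPerm, smul_eq_mul, sub_eq_zero] at hDt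

/-- The polynomial-level character is the case `ρ` arbitrary: part AA's transfer law recovered (with the extra, harmless,
bound `r ≤ ρ + 1` disposed of by taking `ρ = r`). [bookkeeping] -/
theorem evalT_permT_eq_mul_of_lowRank_of_slotChar {k : ℕ} (σ : Equiv.Perm (Fin 3)) {χ : ℂ}
    (hV : ∀ W ∈ hwvSpace (rectType (m' + 1) m' k) (k * m'), MvPolynomial.rename (slotPerm σ) W = χ • W)
    {f : MvPolynomial (Idx (m' + 1)) ℂ} (hf : f ∈ hwvSpace (rectType (m' + 1) (m' + 1) k) (k * (m' + 1)))
    {r : ℕ} (hr : (k - 1) * r < k * (m' + 1)) {t : Tensor ℂ (m' + 1)} (ht : tensorRank t ≤ r) :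
    evalT (permT σ t) f = χ * evalT t f :=
  evalT_permT_eq_mul_of_lowRank (ρ := r) σ (fun W hW s _ => evalT_permT_of_slotChar σ (hV W hW) s) hf hr
    (Nat.le_succ r) ht

end TransferStep

end Summit.MatrixMultiplication.MatrixMultiplication.Theorems.ObstructionCalculus
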